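import Mathlib.Data.Finset.Sups
import Mathlib.Order.UpperLower.Basic
import Summits.CriticalPhenomena.PercolationContinuityZ3.Theorems.PercNearOneGluingNoHeavyLowerTailAntiBandMatching

/-!
# `NoHeavyLowerTail` (crux stmt-CriticalPhenomena-4575), lane prim-ineq-gen-4 (gen 33): the anti-band inequality from a covering map of the CORE only

Support file (`--supports stmt-CriticalPhenomena-4575`; memo `run/shared/lean/prim/prim-ineq-gen-4/FINDING-THRESHOLD-JUNTA-g33.md` §1.4).
Pure finite combinatorics, no definitions, no `sorry`, standard axioms.

(AB_l) for a family `W` and an up-set `V` of finsets of `β` asks `#{s ∈ W ∩ Vᶜˢ | outer s} ≤ #{s ∈ W ∩ V | outer s}`, `outer s :↔ #s < l ∨ #sᶜ < l`.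
Gen 21 (`AntiBandMatching.antiBand_of_covering_map`): it suffices to have a *covering map* of the whole outer part of `W` (an injection `Φ` with `sᶜ ⊆ Φ s`).
HERE (`antiBand_of_core_covering_map`): it suffices to have a covering map of the outer part of the **core** `{s ∈ W | sᶜ ∉ W}` — the members of `W`
whose complement is again in `W` pair off under `s ↦ sᶜ`, which exchanges "`sᶜ ∈ V`" and "`s ∈ V`" and preserves `outer`, so they contribute equally to
both sides.  For an up-set `W` the core `W ∩ W*` is an INTERSECTING up-set; this is the formal version of the reduction "WLOG `P` intersecting" used throughout
the lane's memos (g31 §2, g32 §1), and it is what turns a covering map for the threshold junta `{s | k ≤ #(s ∩ T₀)}` with `#T₀ < 2k` into (AB) for every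
arity (`AntiBandThresholdAll`).  No hypothesis on `W` is needed.
-/

namespace Summit.CriticalPhenomena.PercolationContinuityZ3.Theorems.AntiBandCore

open Finset
open scoped FinsetFamily

variable {β : Type*} [DecidableEq β] [Fintype β]

/-- **(AB_l) from a covering map of the core.**  Let `C = {s ∈ W | sᶜ ∉ W}` (the "core" of `W`) and `C' = {s ∈ C | #s < l ∨ #sᶜ < l}` its outer part.
If `Φ` maps `C'` injectively into `C'` with `sᶜ ⊆ Φ s`, then for every up-set `V`:
`#{s ∈ W ∩ Vᶜˢ | #s < l ∨ #sᶜ < l} ≤ #{s ∈ W ∩ V | #s < l ∨ #sᶜ < l}`.  (The non-core outer members are permuted by `s ↦ sᶜ`, which swaps the two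
counted conditions; the core is gen 21's criterion.) [this work; memo FINDING-THRESHOLD-JUNTA-g33 §1.4] -/
theorem antiBand_of_core_covering_map (l : ℕ) (W V : Finset (Finset β)) (hV : IsUpperSet (V : Set (Finset β)))
    (Φ : Finset β → Finset β)
    (hΦ : ∀ s ∈ (W.filter fun s => sᶜ ∉ W).filter (fun s => #s < l ∨ #sᶜ < l),
      Φ s ∈ (W.filter fun s => sᶜ ∉ W).filter (fun s => #s < l ∨ #sᶜ < l))
    (hcov : ∀ s ∈ (W.filter fun s => sᶜ ∉ W).filter (fun s => #s < l ∨ #sᶜ < l), sᶜ ⊆ Φ s)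
    (hinj : Set.InjOn Φ ↑((W.filter fun s => sᶜ ∉ W).filter (fun s => #s < l ∨ #sᶜ < l))) :
    #((W ∩ Vᶜˢ).filter fun s => #s < l ∨ #sᶜ < l) ≤ #((W ∩ V).filter fun s => #s < l ∨ #sᶜ < l) := by
  classical
  set C : Finset (Finset β) := W.filter fun s => sᶜ ∉ W with hCdef
  -- gen 21 on the core
  have hcore : #((C ∩ Vᶜˢ).filter fun s => #s < l ∨ #sᶜ < l) ≤ #((C ∩ V).filter fun s => #s < l ∨ #sᶜ < l) :=
    AntiBandMatching.antiBand_of_covering_map l C V hV Φ hΦ hcov hinj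
  -- split both sides by the predicate `sᶜ ∈ W`
  have hsplit : ∀ X : Finset (Finset β), #((W ∩ X).filter fun s => #s < l ∨ #sᶜ < l) =
      #(((W ∩ X).filter fun s => #s < l ∨ #sᶜ < l).filter fun s => sᶜ ∈ W) + #((C ∩ X).filter fun s => #s < l ∨ #sᶜ < l) := by
    intro X
    rw [← card_filter_add_card_filter_not (fun s : Finset β => sᶜ ∈ W)]
    congr 2
    ext s
    rw [mem_filter, mem_filter, mem_filter, mem_inter, mem_inter, hCdef, mem_filter]
    constructor
    · rintro ⟨⟨⟨hW, hX⟩, hO⟩, hp⟩; exact ⟨⟨⟨hW, hp⟩, hX⟩, hO⟩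
    · rintro ⟨⟨⟨hW, hp⟩, hX⟩, hO⟩; exact ⟨⟨⟨hW, hX⟩, hO⟩, hp⟩
  -- the self-complementary part has the same size on both sides (`s ↦ sᶜ`)
  have hpair : #(((W ∩ Vᶜˢ).filter fun s => #s < l ∨ #sᶜ < l).filter fun s => sᶜ ∈ W) =
      #(((W ∩ V).filter fun s => #s < l ∨ #sᶜ < l).filter fun s => sᶜ ∈ W) := by
    refine card_bij (fun s _ => sᶜ) (fun s hs => ?_) (fun s _ s' _ h => compl_injective h) (fun s hs => ⟨sᶜ, ?_, compl_compl s⟩)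
    · rw [mem_filter, mem_filter, mem_inter, mem_compls] at hs
      obtain ⟨⟨⟨hW, hV'⟩, hO⟩, hp⟩ := hs
      rw [mem_filter, mem_filter, mem_inter, compl_compl]
      exact ⟨⟨⟨hp, hV'⟩, hO.symm⟩, hW⟩
    · rw [mem_filter, mem_filter, mem_inter] at hs
      obtain ⟨⟨⟨hW, hV'⟩, hO⟩, hp⟩ := hs
      rw [mem_filter, mem_filter, mem_inter, mem_compls, compl_compl]
      exact ⟨⟨⟨hp, hV'⟩, hO.symm⟩, hW⟩
  rw [hsplit Vᶜˢ, hsplit V, hpair]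
  exact Nat.add_le_add_left hcore _

/-- The core of an up-set is an intersecting family: no two of its members are disjoint (if `s, t ∈ W`, `sᶜ ∉ W` and `s ∩ t = ∅` then `t ⊆ sᶜ` would put
`sᶜ` in the up-set `W`).  Recorded for users of `antiBand_of_core_covering_map`. [this work] -/
theorem core_intersecting (W : Finset (Finset β)) (hW : IsUpperSet (W : Set (Finset β)))
    (s t : Finset β) (hs : s ∈ W.filter fun s => sᶜ ∉ W) (ht : t ∈ W.filter fun s => sᶜ ∉ W) : (s ∩ t).Nonempty := by
  rw [mem_filter] at hs ht
  by_contra h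
  rw [not_nonempty_iff_eq_empty] at h
  have hts : t ⊆ sᶜ := by
    intro x hx
    rw [mem_compl]
    intro hxs
    have : x ∈ s ∩ t := mem_inter.2 ⟨hxs, hx⟩
    rw [h] at this
    exact absurd this (notMem_empty x)
  exact hs.2 (hW hts ht.1)

end Summit.CriticalPhenomena.PercolationContinuityZ3.Theorems.AntiBandCore
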